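import Literature.IUT.LogVolume.GenuineRamificationBoundsPinned
import HarnessLib

/-!
# [IUTchIV] Thm. 1.10 Step (iii) (R4) at the genuine Θ-volume datum WITH PRINT'S `e_mod` — the e-term bound
# `p ≤ e*_mod·l`, `3 + log e(K_v̲) ≤ 4·log(e*_mod·l)` for every admissible `e_mod`

S. Mochizuki, *Inter-universal Teichmüller theory IV*, RIMS manuscript (Apr. 2020; = PRIMS **57** (2021)), Thm. 1.10,
p. 22: "let us write `d_mod := [F_mod : ℚ]`, `(1 ≤) e_mod (≤ d_mod)` for the maximal ramification index of `F_mod` [i.e., of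
valuations `∈ 𝕍^non_mod`] over `ℚ`, `d*_mod := 2^12·3^3·5·d_mod`, `e*_mod := 2^12·3^3·5·e_mod (≤ d*_mod)`"; proof Step
(iii) (R4), p. 26: "if `e_v ≥ p_v − 1 > p_v − 2`, then `p_v ≤ e*_mod·l`, and hence `log(e_v) ≤ −3 + 4·log(e*_mod·l)`";
Step (v) p. 28 (`ι_{v_ℚ}`, `l*_mod := log(e*_mod·l)`).

abc-iut-S1's `GenuineRamificationBoundsPinned.lean` proves (R4) for every genuine Θ-volume datum of the cell's reading v3
with the admissible choice `e_mod := d_mod` (`Cor22.ThetaVolumeDatumAt.R4_towerFact`), which is all the downstream chain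
([IUTchIV] Cor. 2.2, which consumes Thm. 1.10 with `d*_mod`) needs. THIS FILE proves the same bound for EVERY natural number
`e ≥ 1` that bounds the ramification indices of `F_mod = ℚ(j(λ))` over `ℚ` — print's `e_mod` is the least such `e` — so that
[IUTchIV] Thm. 1.10's display can be assembled downstream with print's constant `20·(e*_mod·l + η_prm)` VERBATIM
(campaign-S seat abc-iut-S3, Summits-side sequel `LDHGenuineTowerArithEmod`). No new definition: `e_mod` enters as the
hypothesis `hemod : ∀ w ∈ 𝕍(F_mod)^non, e(w | p_w) ≤ e` on the subfield `ℚ(j(λ)) ⊆ F_tpd` (the field of `Cor22.dmod`).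

* `Cor22.ramificationIdx_int_tpd_le_six_mul` — `e(w | p) ≤ 6·e` for every finite place `w` of `F_tpd = ℚ(λ)`:
  `e(w | p) = e(w ∩ F_mod | p)·e(w | w ∩ F_mod) ≤ e·[F_tpd : F_mod] ≤ 6·e` (the tower formula, `ramificationIdx_rel_le_finrank`,
  abc-iut-S-d2's `finrank_adjoin_jInv_le_six`);
* `Cor22.R4_pinned_emod`, `Cor22.R4_pinned_explicit_emod` — abc-iut-S1's `R4_pinned` / `R4_pinned_explicit` with `6·d_mod`
  replaced by `6·e` in the middle layer (same proof: abc-iut-S1's `PlaceSection.R4_localFieldFamily_abs` with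
  `N := 2^12·3^3·5·e`, `M_b := 2^11·3^3·5·e`, `M_c := 2^13·3^3·5·e`, the two-root inertia lemma `ramificationIdx_subThetaField_le`
  at the odd primes, `[K : F] ∣ l(l−1)²(l+1)`, Prop. 1.8 (vii) at the genuine tower);
* `Cor22.ThetaVolumeDatumAt.R4_towerFact_emod` — the bundled form for a datum `T : Cor22.ThetaVolumeDatumAt P l`, the `hR4` of
  abc-iut-c312-d1's `DHData.hullEstimateOf_ofInput_explicit T.I (2^12·3^3·5·e·l)` with `lmod := log((2^12·3^3·5·e)·l)`.
[cite: Mochizuki2012, IUTchIV Thm 1.10 p.22] [cite: Mochizuki2012, IUTchIV Thm 1.10 proof Step (iii) (R4) p.26]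
[cite: Mochizuki2012, IUTchIV Thm 1.10 proof Step (v) p.28]

Proof-only (no definition, no named fact, no instance); classical; TAKES NO SIDE on [IUTchIII] Cor. 3.12 — nothing here
concerns `−|log(Θ)|` itself.
-/

noncomputable section

open scoped Classical

namespace Literature.IUT.LogVolume

namespace Cor22

open NumberField IsDedekindDomain Literature.NumberTheory.DiophantineGeometry.GenEll
open Literature.NumberTheory.EllipticCurves Literature.NumberTheory.GaloisRepresentations
open Literature.NumberTheory.NumberFields Literature.IUT.HodgeTheaters WeierstrassCurve IntermediateField Field

/-! ## `e(w | p) ≤ 6·e` on `F_tpd` -/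

/-- **`e(w | p) ≤ [F_tpd : F_mod]·e ≤ 6·e` for every finite place `w` of `F_tpd = ℚ(λ)`**, whenever `e` bounds the
ramification indices over `ℚ` of the finite places of `F_mod = ℚ(j(λ)) ⊆ F_tpd` (print's "`e_mod` := the maximal ramification
index of `F_mod` over `ℚ`", Thm. 1.10 p. 22, is the least such `e`): tower formula `e(w|p) = e(w ∩ F_mod | p)·e(w | w ∩ F_mod)`,
`e(w | w ∩ F_mod) ≤ [F_tpd : F_mod]` and `[F_tpd : F_mod] ≤ 6` for `λ ∈ U_X` (abc-iut-S-d2 `finrank_adjoin_jInv_le_six`).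
[cite: Mochizuki2012, IUTchIV Thm 1.10 p.22] -/
theorem ramificationIdx_int_tpd_le_six_mul (P : NFPoint) (hP : P ∈ UP) {e : ℕ}
    (hemod : ∀ w : HeightOneSpectrum (𝓞 (IntermediateField.adjoin ℚ ({jInv P.x} : Set P.F))),
      w.asIdeal.ramificationIdx ℤ ≤ e)
    (w : HeightOneSpectrum (𝓞 P.F)) : w.asIdeal.ramificationIdx ℤ ≤ 6 * e := by
  set Fm : IntermediateField ℚ P.F := IntermediateField.adjoin ℚ ({jInv P.x} : Set P.F) with hFm
  have htower : w.asIdeal.ramificationIdx ℤ =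
      (w.asIdeal.under (𝓞 Fm)).ramificationIdx ℤ * w.asIdeal.ramificationIdx (𝓞 Fm) :=
    Ideal.ramificationIdx_tower (R := ℤ) (w.asIdeal.under (𝓞 Fm)) w.asIdeal
  have h1 : (w.asIdeal.under (𝓞 Fm)).ramificationIdx ℤ ≤ e := hemod (finBelow Fm P.F w)
  have h2 : w.asIdeal.ramificationIdx (𝓞 Fm) ≤ 6 :=
    (ramificationIdx_rel_le_finrank (F := Fm) w).trans (finrank_adjoin_jInv_le_six P hP)
  rw [htower]
  calc (w.asIdeal.under (𝓞 Fm)).ramificationIdx ℤ * w.asIdeal.ramificationIdx (𝓞 Fm) ≤ e * 6 := Nat.mul_le_mul h1 h2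
    _ = 6 * e := by ring

section Pinned

variable {P : NFPoint} {F : Type} [Field F] [NumberField F] [Algebra P.F F]
  {K : Type} [Field K] [NumberField K] [Algebra F K]
  {Fbar : Type} [Field Fbar] [Algebra F Fbar] [Algebra K Fbar]
  {E : WeierstrassCurve F} [hE : E.IsElliptic] {l : ℕ} {Pb : BadPlacePredicates K}

/-- The numeric side conditions of `R4_localFieldFamily_abs` for print's constants with a general `e_mod = e`:
`2·(2^11·3^3·5·e) ≤ 2^12·3^3·5·e` and `21·(2^13·3^3·5·e) ≤ (2^12·3^3·5·e)^4`.
[cite: Mochizuki2012, IUTchIV Thm 1.10 proof Step (iii) (R4) p.26] -/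
private theorem constants_emod (e : ℕ) :
    2 * (2 ^ 11 * 3 ^ 3 * 5 * e) ≤ 2 ^ 12 * 3 ^ 3 * 5 * e ∧
      21 * (2 ^ 13 * 3 ^ 3 * 5 * e) ≤ (2 ^ 12 * 3 ^ 3 * 5 * e) ^ 4 := by
  refine ⟨by ring_nf; exact le_rfl, ?_⟩
  have h1 : e ≤ e ^ 4 := Nat.le_self_pow (by norm_num) e
  calc 21 * (2 ^ 13 * 3 ^ 3 * 5 * e) = (21 * (2 ^ 13 * 3 ^ 3 * 5)) * e := by ring
    _ ≤ (2 ^ 12 * 3 ^ 3 * 5) ^ 4 * e ^ 4 := Nat.mul_le_mul (by norm_num) h1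
    _ = (2 ^ 12 * 3 ^ 3 * 5 * e) ^ 4 := by ring

/-- **(R4) for the tower of a genuine Θ-volume datum (reading v3) with PRINT'S `e_mod`** ([IUTchIV] Thm. 1.10 Step (iii)
(R4) p. 26 / Step (v) p. 28): for `P ∈ U`, a field `F` pinned by `IsSubThetaField P F`, an elliptic curve `E/F` with
`j(E) = j(λ)`, initial Θ-data `D` over `E`, ANY genuine input `I : ThetaVolumeInput F_mod K`, and any `e ≥ 1` bounding the
ramification indices over `ℚ` of the finite places of `F_mod = ℚ(j(λ))` (`hemod`): at every `v ∈ V(F_mod)_p`,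
`p − 2 < e(K_{v̲}) ⟹ 3 + log e(K_{v̲}) ≤ 4·ι_p·l*_mod` with `ι_p = (p ≤ e*_mod·l ? 1 : 0)`, `l*_mod = log(e*_mod·l)`,
`e*_mod = 2^12·3^3·5·e`. abc-iut-S1's proof of `R4_pinned` verbatim with the middle-layer bound `e(w ∩ F_tpd | p) ≤ 6·e`
(`ramificationIdx_int_tpd_le_six_mul`) in place of `≤ 6·d_mod`. [cite: Mochizuki2012, IUTchIV Thm 1.10 proof Step (iii) (R4) p.26]
[cite: Mochizuki2012, IUTchIV Thm 1.10 proof Step (v) p.28] -/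
theorem R4_pinned_emod (hP : P ∈ UP) (hF : IsSubThetaField P F) (hj : E.j = algebraMap P.F F (jInv P.x))
    (D : InitialThetaData F K Fbar E l Pb) (I : ThetaVolumeInput (fieldOfModuli E) K) {e : ℕ} (he : 1 ≤ e)
    (hemod : ∀ w : HeightOneSpectrum (𝓞 (IntermediateField.adjoin ℚ ({jInv P.x} : Set P.F))),
      w.asIdeal.ramificationIdx ℤ ≤ e)
    {p : ℕ} [hp : Fact p.Prime] (v : placesOver (fieldOfModuli E) p) :
    p - 2 < absRamificationIdx p ((I.σ.localFieldFamily p hp.out).k v) →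
      3 + Real.log (absRamificationIdx p ((I.σ.localFieldFamily p hp.out).k v)) ≤
        4 * (if p ≤ 2 ^ 12 * 3 ^ 3 * 5 * e * l then (1 : ℝ) else 0) *
          Real.log (((2 ^ 12 * 3 ^ 3 * 5 * e : ℕ) : ℝ) * l) := by
  have hU : P.InU := hP.1
  have hl : l.Prime := D.l_prime
  haveI : Fact l.Prime := ⟨hl⟩
  haveI := D.isScalarTower
  haveI := D.isAlgClosure
  haveI := D.isGalois_fieldOfModuli
  haveI : IsGalois P.F F := isGalois_tpd_of_isGalois_fieldOfModuli hj
  haveI : IsGalois F K := isGalois_F_K_of_initialThetaData D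
  -- the embedding `K → AlgebraicClosure F` inside the `l`-division field
  let ι : Fbar ≃ₐ[F] AlgebraicClosure F := IsAlgClosure.equiv F Fbar (AlgebraicClosure F)
  let ψ : K →ₐ[F] AlgebraicClosure F :=
    (ι : Fbar →ₐ[F] AlgebraicClosure F).comp (IsScalarTower.toAlgHom F K Fbar)
  have hK : (E.galoisRepTorsion (l : ℤ)).ker ≤ ψ.fieldRange.fixingSubgroup :=
    ker_galoisRepTorsion_le_fixingSubgroup_of_initialThetaData D ι
  have hss : E.IsSemistable (𝓞 F) := D.isSemistable
  -- the places: `u = v̲` of `K`, `w = u ∩ F`, `w ∩ F_tpd`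
  set u : HeightOneSpectrum (𝓞 K) := I.σ.lift v.1 with hu
  set w : HeightOneSpectrum (𝓞 F) := finBelow F K u with hw
  have hpu : ((p : ℕ) : 𝓞 K) ∈ u.asIdeal := I.σ.natCast_mem_lift v
  have hpw : ((p : ℕ) : 𝓞 F) ∈ w.asIdeal := by
    change ((p : ℕ) : 𝓞 F) ∈ u.asIdeal.under (𝓞 F)
    rw [Ideal.under_def, Ideal.mem_comap, map_natCast]
    exact hpu
  -- the middle layer's absolute index: `e(w | p) = e(w ∩ F_tpd | p) · e(w | w ∩ F_tpd)`
  have htower : w.asIdeal.ramificationIdx ℤ =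
      (w.asIdeal.under (𝓞 P.F)).ramificationIdx ℤ * w.asIdeal.ramificationIdx (𝓞 P.F) :=
    Ideal.ramificationIdx_tower (R := ℤ) (w.asIdeal.under (𝓞 P.F)) w.asIdeal
  -- PRINT'S STEP: `e(w ∩ F_tpd | p) ≤ [F_tpd : F_mod]·e_mod ≤ 6·e`
  have htpd : (w.asIdeal.under (𝓞 P.F)).ramificationIdx ℤ ≤ 6 * e :=
    ramificationIdx_int_tpd_le_six_mul P hP hemod (finBelow P.F F w)
  -- crude bound: `e(w | F_tpd) ≤ [F : F_tpd] ≤ 2²·46080`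
  have hcrude : (u.asIdeal.under (𝓞 F)).ramificationIdx ℤ ≤ 2 ^ 13 * 3 ^ 3 * 5 * e := by
    change w.asIdeal.ramificationIdx ℤ ≤ _
    rw [htower]
    calc (w.asIdeal.under (𝓞 P.F)).ramificationIdx ℤ * w.asIdeal.ramificationIdx (𝓞 P.F)
        ≤ (6 * e) * (2 ^ 2 * 46080) :=
          Nat.mul_le_mul htpd ((ramificationIdx_rel_le_finrank w).trans (hF.finrank_le_bound P hU))
      _ = 2 ^ 13 * 3 ^ 3 * 5 * e := by ring
  -- void-branch bound at the (odd) primes `p > e*_mod·l`: the two-root lemma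
  have hbig : 2 ^ 12 * 3 ^ 3 * 5 * e * l < p →
      (u.asIdeal.under (𝓞 F)).ramificationIdx ℤ ≤ 2 ^ 11 * 3 ^ 3 * 5 * e := by
    intro hbigp
    have hp2 : p ≠ 2 := by
      intro h; subst h
      have h2l : 2 ^ 12 * 3 ^ 3 * 5 * 1 * 2 ≤ 2 ^ 12 * 3 ^ 3 * 5 * e * l :=
        Nat.mul_le_mul (Nat.mul_le_mul_left _ he) hl.two_le
      omega
    have h2 : ((2 : ℕ) : 𝓞 P.F) ∉ (finBelow P.F F w).asIdeal :=
      natCast_not_mem_under_of_ne (F := P.F) w hp.out Nat.prime_two hpw hp2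
    change w.asIdeal.ramificationIdx ℤ ≤ _
    rw [htower]
    calc (w.asIdeal.under (𝓞 P.F)).ramificationIdx ℤ * w.asIdeal.ramificationIdx (𝓞 P.F)
        ≤ (6 * e) * 46080 := Nat.mul_le_mul htpd (ramificationIdx_subThetaField_le F hU hF w h2)
      _ = 2 ^ 11 * 3 ^ 3 * 5 * e := by ring
  -- the `K`-layer
  have hKF : Module.finrank F K ∣ l * (l - 1) ^ 2 * (l + 1) := finrank_dvd_of_ker_le ψ hK
  have htame : ((l : ℕ) : 𝓞 F) ∉ u.asIdeal.under (𝓞 F) → u.asIdeal.ramificationIdx (𝓞 F) ∣ l := by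
    intro hlu
    obtain ⟨k, hk⟩ := exists_ramificationIdx_eq_pow_of_ker_le ψ hss hj hl hK u hlu
    exact ramificationIdx_dvd_prime_of_eq_pow u hl hk hKF
  obtain ⟨hNb, hNc⟩ := constants_emod e
  exact I.σ.R4_localFieldFamily_abs (F := F) v hNb hNc hcrude hbig hl hKF htame

/-- **(R4) with print's `e_mod`, explicit shape** (the `hR4` of abc-iut-c312-d1's `DHData.hullEstimateOf_ofInput_explicit`
with `N := e*_mod·l`, `lmod := log(e*_mod·l)`): under the hypotheses of `R4_pinned_emod`, `p − 2 < e(K_{v̲})` FORCES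
`p ≤ e*_mod·l` (print: "then `p_v ≤ e*_mod·l`") and `3 + log e(K_{v̲}) ≤ 4·log(e*_mod·l)` (print: "`log(e_v) ≤ −3 +
4·log(e*_mod·l)`"). [cite: Mochizuki2012, IUTchIV Thm 1.10 proof Step (iii) (R4) p.26] -/
theorem R4_pinned_explicit_emod (hP : P ∈ UP) (hF : IsSubThetaField P F) (hj : E.j = algebraMap P.F F (jInv P.x))
    (D : InitialThetaData F K Fbar E l Pb) (I : ThetaVolumeInput (fieldOfModuli E) K) {e : ℕ} (he : 1 ≤ e)
    (hemod : ∀ w : HeightOneSpectrum (𝓞 (IntermediateField.adjoin ℚ ({jInv P.x} : Set P.F))),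
      w.asIdeal.ramificationIdx ℤ ≤ e)
    {p : ℕ} [hp : Fact p.Prime] (v : placesOver (fieldOfModuli E) p)
    (hpe : p - 2 < absRamificationIdx p ((I.σ.localFieldFamily p hp.out).k v)) :
    p ≤ 2 ^ 12 * 3 ^ 3 * 5 * e * l ∧
      3 + Real.log (absRamificationIdx p ((I.σ.localFieldFamily p hp.out).k v)) ≤
        4 * Real.log (((2 ^ 12 * 3 ^ 3 * 5 * e : ℕ) : ℝ) * l) := by
  have h := R4_pinned_emod hP hF hj D I he hemod v hpe
  by_cases hle : p ≤ 2 ^ 12 * 3 ^ 3 * 5 * e * l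
  · rw [if_pos hle, mul_one] at h
    exact ⟨hle, h⟩
  · exfalso
    rw [if_neg hle, mul_zero, zero_mul] at h
    have h0 : (0 : ℝ) ≤ Real.log (absRamificationIdx p ((I.σ.localFieldFamily p hp.out).k v)) :=
      Real.log_natCast_nonneg _
    linarith

end Pinned

/-! ### The bundled form, for a genuine Θ-volume datum `T : ThetaVolumeDatumAt P l` (reading v3) -/

namespace ThetaVolumeDatumAt

variable {P : NFPoint} {l : ℕ} (T : ThetaVolumeDatumAt P l)

/-- **(R4) with print's `e_mod` for EVERY genuine Θ-volume datum, junction shape** — the `hR4` of abc-iut-c312-d1's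
`DHData.hullEstimateOf_ofInput_explicit T.I (2^12·3^3·5·e·l)` with `lmod := log((2^12·3^3·5·e)·l)`, for `λ ∈ U_X` minimally
presented and any `e ≥ 1` bounding the ramification indices over `ℚ` of the finite places of `F_mod = ℚ(j(λ))`; NO other
hypothesis. With `e := d_mod` this is abc-iut-S1's `R4_towerFact`. [cite: Mochizuki2012, IUTchIV Thm 1.10 proof Step (iii) (R4) p.26]
[cite: Mochizuki2012, IUTchIV Thm 1.10 proof Step (v) p.28] -/
theorem R4_towerFact_emod (hP : P ∈ UP) {e : ℕ} (he : 1 ≤ e)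
    (hemod : ∀ w : HeightOneSpectrum (𝓞 (IntermediateField.adjoin ℚ ({jInv P.x} : Set P.F))),
      w.asIdeal.ramificationIdx ℤ ≤ e) :
    (letI := T.instFieldF; letI := T.instNumberFieldF; letI := T.instAlgebraF; letI := T.instFieldK
     letI := T.instNumberFieldK; letI := T.instAlgebraK; letI := T.instFieldFbar; letI := T.instAlgebraFbar
     letI := T.instAlgebraKFbar; letI := T.instIsElliptic
     ∀ (p : ℕ) [hp : Fact p.Prime], p ∈ T.I.supportPrimes → ∀ v : placesOver (fieldOfModuli T.E) p,
       p - 2 < absRamificationIdx p ((T.I.σ.localFieldFamily p hp.out).k v) →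
         p ≤ 2 ^ 12 * 3 ^ 3 * 5 * e * l ∧
           3 + Real.log (absRamificationIdx p ((T.I.σ.localFieldFamily p hp.out).k v)) ≤
             4 * Real.log (((2 ^ 12 * 3 ^ 3 * 5 * e : ℕ) : ℝ) * l)) := by
  letI := T.instFieldF; letI := T.instNumberFieldF; letI := T.instAlgebraF; letI := T.instFieldK
  letI := T.instNumberFieldK; letI := T.instAlgebraK; letI := T.instFieldFbar; letI := T.instAlgebraFbar
  letI := T.instAlgebraKFbar; letI := T.instIsElliptic
  intro p hp _ v hpe
  exact R4_pinned_explicit_emod hP T.isSubThetaField T.j_eq T.D T.I he hemod v hpe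

/-- **`e := d_mod` is admissible**: every finite place `w` of `F_mod = ℚ(j(λ))` has `e(w | p) ≤ [F_mod : ℚ] = d_mod` (print:
"`(1 ≤) e_mod (≤ d_mod)`", Thm. 1.10 p. 22) — so the `e_mod`-form specialises to abc-iut-S1's `d_mod`-form.
[cite: Mochizuki2012, IUTchIV Thm 1.10 p.22] -/
theorem ramificationIdx_fieldOfModuliPt_le_dmod (P : NFPoint)
    (w : HeightOneSpectrum (𝓞 (IntermediateField.adjoin ℚ ({jInv P.x} : Set P.F)))) :
    w.asIdeal.ramificationIdx ℤ ≤ Cor22.dmod P :=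
  ramificationIdx_int_le_finrank_rat w

end ThetaVolumeDatumAt

end Cor22

end Literature.IUT.LogVolume

end
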